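import Mathlib
import Summits.ValiantsHypothesis.ValiantsHypothesis.Theorems.SymmetroidPencilBasics

/-!
# ValiantsHypothesis / LacunarySymmetroid — crux `MatrixDescartes` (stmt-ValiantsHypothesis-18050),
# line `Cruxes/MatrixDescartes/Lines/sign_split.lean`, stub `stub_perturb` (`PerturbToAlternation`,
# = `lorentzian_shadow`'s `stub_perturbT8`): PARTIAL LEMMAS — the GLOBAL COUNT from a local splitting lemma

Helper file (`--supports stmt-ValiantsHypothesis-18050 --as helper`; cell val-lit, seat val-lit-p5 g9, merged desk
RULING #80).  Closes NO item and does NOT prove the stub; «V1 line stub; `MatrixDescartes` / Conjecture B /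
`VP ≠ VNP` OPEN».

`PerturbToAlternation` (hypothesis: every symmetric pencil of format `(d, m)` has at most `B` strict sign alternations
of its determinant along positive points; conclusion: every symmetric pencil of that format has at most `2B` distinct
positive roots) is reduced here, sorry-free, to a LOCAL SPLITTING LEMMA per positive root — the honest residual:

* **`exists_chain_of_pairs`** — ASSEMBLY: `M` ordered, pairwise separated pairs `a_k < b_k` of positive points with
  `f(a_k) f(b_k) < 0` give a strictly increasing positive chain `τ_0 < ⋯ < τ_M` along which `f` strictly alternates;
* **`card_posRoots_le_two_mul_of_localSplit`** — ABSTRACT GLOBAL COUNT: if, for a two-parameter family of test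
  functions `f s ε` (`s = ±1`, `ε > 0`), every alternating chain has length `≤ B`, and every positive root `ρ` of a
  real polynomial `p` SPLITS LOCALLY (for one sign `s` and every `δ > 0` there is `ε₀ > 0` such that for all
  `0 < ε < ε₀` the function `f s ε` changes sign inside `(ρ - δ, ρ + δ)`), then `p` has at most `2B` distinct positive
  roots (separate the roots, take `ε` below the minimum of the finitely many `ε₀`, assemble one chain per sign,
  pigeonhole over the two signs);
* **`posRootCount_le_of_localSplit`** — the stub's conclusion `posRootCount ≤ 2B` for a symmetric pencil `S` under
  the stub's hypothesis, GIVEN the local splitting property of the perturbed pencils `S[l₀ ↦ S_{l₀} + sε E]`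
  (`E` symmetric; they stay in the format `(d, m)`, so the hypothesis bounds their alternations).

What remains for the stub itself (NOT proved here): the local splitting lemma — at a positive root of `det F` of odd
multiplicity it is continuity in `ε`; at a root of even multiplicity it is the spectral statement «for a generic
`E ≻ 0` and one sign `s`, `det (F(t) + sε t^{d_{l₀}} E)` changes sign near the root for all small `ε`» (parity of the
level crossings of the ordered spectrum of `E^{-1/2} F(t) E^{-1/2}`; `E = 1` fails on `F(t) = (t-1)·1₂`).
-/

set_option linter.dupNamespace false

namespace Summit.ValiantsHypothesis.ValiantsHypothesis.Theorems.LacunarySymmetroidMatrixDescartes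

open Polynomial Finset

namespace Perturb

/-! ## 1. Assembly of separated sign-change pairs into an alternating chain -/

/-- Sign bookkeeping: `f(τ) f(b) ≥ 0`, `f(a) f(b) < 0`, `f(τ) ≠ 0` ⇒ `f(τ) f(a) < 0`. -/
theorem mul_neg_of_same_side {u v w : ℝ} (hu : u ≠ 0) (huv : ¬ u * w < 0) (hvw : v * w < 0) : u * v < 0 := by
  have hw : w ≠ 0 := by rintro rfl; simp at hvw
  have huw : 0 < u * w := lt_of_le_of_ne (not_lt.mp huv) (Ne.symm (mul_ne_zero hu hw))
  by_contra h
  have h' : 0 ≤ u * v := not_lt.mp h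
  have : 0 ≤ u * v * (w * w) := mul_nonneg h' (mul_self_nonneg w)
  nlinarith [mul_pos_of_neg_of_neg hvw hvw, huw]

/-- **Assembly lemma.**  `M` pairs of positive points `a_k < b_k`, separated (`b_k < a_{k'}` for `k < k'`), each
carrying a sign change of `f`, yield positive points `τ_0 < ⋯ < τ_M` along which `f` strictly alternates. -/
theorem exists_chain_of_pairs (f : ℝ → ℝ) (M : ℕ) (a b : Fin M → ℝ) (hab : ∀ k, a k < b k)
    (hsep : ∀ k k' : Fin M, k < k' → b k < a k') (hpos : ∀ k, 0 < a k)
    (hsign : ∀ k, f (a k) * f (b k) < 0) :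
    ∃ τ : Fin (M + 1) → ℝ, StrictMono τ ∧ (∀ j, 0 < τ j) ∧
      ∀ j : Fin M, f (τ j.castSucc) * f (τ j.succ) < 0 := by
  rcases Nat.eq_zero_or_pos M with hM | hM
  · subst hM
    exact ⟨fun _ => 1, fun i j h => absurd h (by simp [Fin.eq_zero i, Fin.eq_zero j]), fun _ => one_pos,
      fun j => j.elim0⟩
  -- ℕ-indexed copies of the data
  let aN : ℕ → ℝ := fun k => if h : k < M then a ⟨k, h⟩ else 0
  let bN : ℕ → ℝ := fun k => if h : k < M then b ⟨k, h⟩ else 0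
  have haN : ∀ k : Fin M, aN k = a k := fun k => by simp [aN, k.2]
  have hbN : ∀ k : Fin M, bN k = b k := fun k => by simp [bN, k.2]
  -- the greedy chain
  let τN : ℕ → ℝ := fun k => Nat.rec (aN 0) (fun k t => if f t * f (bN k) < 0 then bN k else aN k) k
  have hτ0 : τN 0 = aN 0 := rfl
  have hτs : ∀ k, τN (k + 1) = if f (τN k) * f (bN k) < 0 then bN k else aN k := fun k => rfl
  -- one step: from a nonzero value we always move to an opposite sign
  have hstep : ∀ k, k < M → f (τN k) ≠ 0 → f (τN k) * f (τN (k + 1)) < 0 := by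
    intro k hk hne
    rw [hτs]
    by_cases hc : f (τN k) * f (bN k) < 0
    · rw [if_pos hc]; exact hc
    · rw [if_neg hc]
      have hs : f (aN k) * f (bN k) < 0 := by
        rw [show aN k = a ⟨k, hk⟩ from haN ⟨k, hk⟩, show bN k = b ⟨k, hk⟩ from hbN ⟨k, hk⟩]
        exact hsign ⟨k, hk⟩
      exact mul_neg_of_same_side hne hc hs
  have hmain : ∀ k, k < M → f (τN k) ≠ 0 ∧ f (τN k) * f (τN (k + 1)) < 0 := by
    intro k
    induction k with
    | zero =>
      intro h0
      have hne : f (τN 0) ≠ 0 := by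
        rw [hτ0, show aN 0 = a ⟨0, h0⟩ from haN ⟨0, h0⟩]
        intro h
        have := hsign ⟨0, h0⟩
        rw [h, zero_mul] at this
        exact lt_irrefl 0 this
      exact ⟨hne, hstep 0 h0 hne⟩
    | succ k ih =>
      intro hk
      have hne : f (τN (k + 1)) ≠ 0 := by
        intro h
        have := (ih (Nat.lt_of_succ_lt hk)).2
        rw [h, mul_zero] at this
        exact lt_irrefl 0 this
      exact ⟨hne, hstep (k + 1) hk hne⟩
  -- values stay among the pair points, hence increase
  have hmem : ∀ k, k < M → τN (k + 1) = aN k ∨ τN (k + 1) = bN k := by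
    intro k hk
    rw [hτs]
    split_ifs
    · exact Or.inr rfl
    · exact Or.inl rfl
  have hτ1 : τN (0 + 1) = bN 0 := by
    rw [hτs, if_pos]
    rw [hτ0, show aN 0 = a ⟨0, hM⟩ from haN ⟨0, hM⟩, show bN 0 = b ⟨0, hM⟩ from hbN ⟨0, hM⟩]
    exact hsign ⟨0, hM⟩
  have hincr : ∀ k, k < M → τN k < τN (k + 1) := by
    intro k hk
    rcases Nat.eq_zero_or_pos k with rfl | hk0
    · rw [hτ1, hτ0, show aN 0 = a ⟨0, hM⟩ from haN ⟨0, hM⟩, show bN 0 = b ⟨0, hM⟩ from hbN ⟨0, hM⟩]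
      exact hab ⟨0, hM⟩
    · obtain ⟨k', rfl⟩ : ∃ k', k = k' + 1 := ⟨k - 1, by omega⟩
      have hk' : k' < M := by omega
      have h1 : τN (k' + 1) ≤ bN k' := by
        rcases hmem k' hk' with h | h
        · rw [h, show aN k' = a ⟨k', hk'⟩ from haN ⟨k', hk'⟩, show bN k' = b ⟨k', hk'⟩ from hbN ⟨k', hk'⟩]
          exact (hab _).le
        · rw [h]
      have h2 : aN (k' + 1) ≤ τN (k' + 1 + 1) := by
        rcases hmem (k' + 1) hk with h | h
        · rw [h]
        · rw [h, show aN (k' + 1) = a ⟨k' + 1, hk⟩ from haN ⟨k' + 1, hk⟩,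
            show bN (k' + 1) = b ⟨k' + 1, hk⟩ from hbN ⟨k' + 1, hk⟩]
          exact (hab _).le
      have h3 : bN k' < aN (k' + 1) := by
        rw [show aN (k' + 1) = a ⟨k' + 1, hk⟩ from haN ⟨k' + 1, hk⟩,
          show bN k' = b ⟨k', hk'⟩ from hbN ⟨k', hk'⟩]
        exact hsep ⟨k', hk'⟩ ⟨k' + 1, hk⟩ (by simp [Fin.lt_def])
      linarith
  have hposN : ∀ k, k ≤ M → 0 < τN k := by
    intro k hk
    induction k with
    | zero => rw [hτ0, show aN 0 = a ⟨0, hM⟩ from haN ⟨0, hM⟩]; exact hpos _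
    | succ k ih => exact (ih (Nat.le_of_succ_le hk)).trans (hincr k hk)
  refine ⟨fun j => τN j, Fin.strictMono_iff_lt_succ.mpr fun j => ?_, fun j => hposN j (Nat.lt_succ_iff.mp j.2),
    fun j => ?_⟩
  · simpa [Fin.val_succ] using hincr j j.2
  · simpa [Fin.val_succ] using (hmain j j.2).2

/-! ## 2. The abstract global count -/

/-- **Global count from local splitting.**  `f s ε` (`s = ±1`, `ε > 0`) is a family of test functions all of whose
alternating chains along positive points have length `≤ B`; every positive root `ρ` of the real polynomial `p`
splits locally (for one sign `s` and every `δ > 0` there is `ε₀ > 0` such that for all `0 < ε < ε₀`, `f s ε`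
changes sign strictly inside `(ρ - δ, ρ + δ)`).  Then `p` has at most `2B` distinct positive roots. -/
theorem card_posRoots_le_two_mul_of_localSplit (p : ℝ[X]) (f : ℝ → ℝ → ℝ → ℝ) (B : ℕ)
    (hB : ∀ s ε : ℝ, (s = 1 ∨ s = -1) → 0 < ε → ∀ (N : ℕ) (τ : Fin (N + 1) → ℝ), StrictMono τ →
      (∀ j, 0 < τ j) → (∀ j : Fin N, f s ε (τ j.castSucc) * f s ε (τ j.succ) < 0) → N ≤ B)
    (hloc : ∀ ρ ∈ p.roots.toFinset.filter (fun ρ => 0 < ρ), ∃ s : ℝ, (s = 1 ∨ s = -1) ∧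
      ∀ δ : ℝ, 0 < δ → ∃ ε₀ : ℝ, 0 < ε₀ ∧ ∀ ε : ℝ, 0 < ε → ε < ε₀ →
        ∃ a b : ℝ, ρ - δ < a ∧ a < b ∧ b < ρ + δ ∧ f s ε a * f s ε b < 0) :
    (p.roots.toFinset.filter fun ρ => 0 < ρ).card ≤ 2 * B := by
  classical
  set P := p.roots.toFinset.filter fun ρ => 0 < ρ with hPdef
  have hPpos : ∀ ρ ∈ P, 0 < ρ := fun ρ hρ => (Finset.mem_filter.mp hρ).2
  choose! sgn hsgn hsplit using hloc
  -- one chain per sign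
  have key : ∀ s₀ : ℝ, (s₀ = 1 ∨ s₀ = -1) → (P.filter fun ρ => sgn ρ = s₀).card ≤ B := by
    intro s₀ hs₀
    set G := P.filter fun ρ => sgn ρ = s₀ with hGdef
    have hGP : ∀ ρ ∈ G, ρ ∈ P := fun ρ hρ => (Finset.mem_filter.mp hρ).1
    rcases Nat.eq_zero_or_pos G.card with h0 | hGpos
    · rw [h0]; exact Nat.zero_le _
    have hGne : G.Nonempty := Finset.card_pos.mp hGpos
    -- separation scale: half the least gap among `0` and the positive roots
    set Q := insert (0 : ℝ) P with hQdef
    set D := ((Q ×ˢ Q).filter fun uv : ℝ × ℝ => uv.1 < uv.2).image fun uv => uv.2 - uv.1 with hDdef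
    have hDne : D.Nonempty := by
      obtain ⟨ρ, hρ⟩ := hGne
      refine ⟨ρ - 0, Finset.mem_image.mpr ⟨(0, ρ), Finset.mem_filter.mpr ⟨Finset.mem_product.mpr
        ⟨Finset.mem_insert_self _ _, Finset.mem_insert_of_mem (hGP ρ hρ)⟩, hPpos ρ (hGP ρ hρ)⟩, rfl⟩⟩
    have hDpos : ∀ x ∈ D, 0 < x := by
      intro x hx
      obtain ⟨uv, huv, rfl⟩ := Finset.mem_image.mp hx
      exact sub_pos.mpr (Finset.mem_filter.mp huv).2
    set δ := D.min' hDne / 2 with hδdef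
    have hδpos : 0 < δ := by
      have := hDpos _ (Finset.min'_mem D hDne)
      rw [hδdef]; linarith
    have hgap : ∀ u ∈ Q, ∀ v ∈ Q, u < v → 2 * δ ≤ v - u := by
      intro u hu v hv huv
      have hmem : v - u ∈ D := Finset.mem_image.mpr ⟨(u, v), Finset.mem_filter.mpr
        ⟨Finset.mem_product.mpr ⟨hu, hv⟩, huv⟩, rfl⟩
      have := Finset.min'_le D _ hmem
      rw [hδdef]; linarith
    -- ε below every local threshold
    have hthr : ∀ ρ ∈ G, ∃ ε₀ : ℝ, 0 < ε₀ ∧ ∀ ε : ℝ, 0 < ε → ε < ε₀ →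
        ∃ a b : ℝ, ρ - δ < a ∧ a < b ∧ b < ρ + δ ∧ f s₀ ε a * f s₀ ε b < 0 := by
      intro ρ hρ
      have h := hsplit ρ (hGP ρ hρ) δ hδpos
      rw [(Finset.mem_filter.mp hρ).2] at h
      exact h
    choose! ε₀ hε₀pos hε₀ using hthr
    set ε := (G.image ε₀).min' (hGne.image ε₀) / 2 with hεdef
    have hεpos : 0 < ε := by
      obtain ⟨ρ, hρ, hρeq⟩ := Finset.mem_image.mp (Finset.min'_mem (G.image ε₀) (hGne.image ε₀))
      have := hε₀pos ρ hρ
      rw [hεdef, ← hρeq]; linarith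
    have hεlt : ∀ ρ ∈ G, ε < ε₀ ρ := by
      intro ρ hρ
      have := Finset.min'_le (G.image ε₀) (ε₀ ρ) (Finset.mem_image_of_mem ε₀ hρ)
      have hp := hε₀pos ρ hρ
      rw [hεdef]; linarith
    -- the sign-change pairs
    have hpairs : ∀ ρ ∈ G, ∃ a b : ℝ, ρ - δ < a ∧ a < b ∧ b < ρ + δ ∧ f s₀ ε a * f s₀ ε b < 0 :=
      fun ρ hρ => hε₀ ρ hρ ε hεpos (hεlt ρ hρ)
    choose! a b ha hab hb hsign using hpairs
    -- enumerate G increasingly and assemble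
    set M := G.card
    let g : Fin M ↪o ℝ := G.orderEmbOfFin rfl
    have hgG : ∀ k, g k ∈ G := fun k => Finset.orderEmbOfFin_mem G rfl k
    have hgQ : ∀ k, g k ∈ Q := fun k => Finset.mem_insert_of_mem (hGP _ (hgG k))
    obtain ⟨τ, hmono, hτpos, halt⟩ := exists_chain_of_pairs (f s₀ ε) M (fun k => a (g k)) (fun k => b (g k))
      (fun k => hab _ (hgG k))
      (fun k k' hkk' => by
        have h2 := hgap (g k) (hgQ k) (g k') (hgQ k') (g.strictMono hkk')
        have := hb _ (hgG k); have := ha _ (hgG k'); linarith)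
      (fun k => by
        have h2 := hgap 0 (Finset.mem_insert_self _ _) (g k) (hgQ k) (hPpos _ (hGP _ (hgG k)))
        have := ha _ (hgG k); linarith)
      (fun k => hsign _ (hgG k))
    exact hB s₀ ε hs₀ hεpos M τ hmono hτpos halt
  -- pigeonhole over the two signs
  have hsplitP : P = (P.filter fun ρ => sgn ρ = 1) ∪ (P.filter fun ρ => sgn ρ = -1) := by
    ext ρ
    simp only [Finset.mem_union, Finset.mem_filter]
    constructor
    · intro h
      rcases hsgn ρ h with h1 | h1
      · exact Or.inl ⟨h, h1⟩
      · exact Or.inr ⟨h, h1⟩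
    · rintro (⟨h, -⟩ | ⟨h, -⟩) <;> exact h
  calc P.card = ((P.filter fun ρ => sgn ρ = 1) ∪ (P.filter fun ρ => sgn ρ = -1)).card := by rw [← hsplitP]
    _ ≤ (P.filter fun ρ => sgn ρ = 1).card + (P.filter fun ρ => sgn ρ = -1).card := Finset.card_union_le _ _
    _ ≤ B + B := Nat.add_le_add (key 1 (Or.inl rfl)) (key (-1) (Or.inr rfl))
    _ = 2 * B := by ring

/-! ## 3. The stub's conclusion from the local splitting of the perturbed pencils -/

/-- Perturbing one coefficient by a symmetric matrix keeps the pencil symmetric (same format). -/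
theorem isSymm_update_add_smul {K m : ℕ} (S : Fin K → Matrix (Fin m) (Fin m) ℝ) (hS : ∀ l, (S l).IsSymm)
    (l₀ : Fin K) (E : Matrix (Fin m) (Fin m) ℝ) (hE : E.IsSymm) (c : ℝ) (l : Fin K) :
    (Function.update S l₀ (S l₀ + c • E) l).IsSymm := by
  by_cases h : l = l₀
  · subst h
    rw [Function.update_self]
    exact (hS l).add (hE.smul c)
  · rw [Function.update_of_ne h]
    exact hS l

/-- **`PerturbToAlternation` from local splitting (the stub's global half).**  Under the stub's hypothesis for the
format `(d, m)` with bound `B`, a symmetric pencil `S` has `posRootCount ≤ 2B` AS SOON AS every positive root of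
`det F_S` splits locally for the perturbed pencils `S[l₀ ↦ S_{l₀} + sε E]` (`E` symmetric): for one sign `s = ±1`
and every `δ > 0`, for all small `ε > 0` the perturbed determinant changes sign strictly inside `(ρ - δ, ρ + δ)`.
The local splitting itself (odd roots: continuity; even roots: generic `E ≻ 0`) is the part NOT proved here. -/
theorem posRootCount_le_of_localSplit (K m : ℕ) (d : Fin K → ℕ) (B : ℕ)
    (H : ∀ S : Fin K → Matrix (Fin m) (Fin m) ℝ, (∀ l, (S l).IsSymm) →
      ∀ (N : ℕ) (τ : Fin (N + 1) → ℝ),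
        (StrictMono τ ∧ (∀ j, 0 < τ j) ∧ ∀ j : Fin N,
          (∑ l, (Polynomial.X : ℝ[X]) ^ d l • (S l).map Polynomial.C).det.eval (τ j.castSucc) *
            (∑ l, (Polynomial.X : ℝ[X]) ^ d l • (S l).map Polynomial.C).det.eval (τ j.succ) < 0) → N ≤ B)
    (S : Fin K → Matrix (Fin m) (Fin m) ℝ) (hS : ∀ l, (S l).IsSymm)
    (l₀ : Fin K) (E : Matrix (Fin m) (Fin m) ℝ) (hE : E.IsSymm)
    (hloc : ∀ ρ ∈ ((∑ l, (Polynomial.X : ℝ[X]) ^ d l • (S l).map Polynomial.C).det.roots.toFinset.filter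
        fun ρ => 0 < ρ), ∃ s : ℝ, (s = 1 ∨ s = -1) ∧ ∀ δ : ℝ, 0 < δ → ∃ ε₀ : ℝ, 0 < ε₀ ∧ ∀ ε : ℝ, 0 < ε → ε < ε₀ →
        ∃ a b : ℝ, ρ - δ < a ∧ a < b ∧ b < ρ + δ ∧
          (∑ l, (Polynomial.X : ℝ[X]) ^ d l •
              (Function.update S l₀ (S l₀ + (s * ε) • E) l).map Polynomial.C).det.eval a *
            (∑ l, (Polynomial.X : ℝ[X]) ^ d l •
              (Function.update S l₀ (S l₀ + (s * ε) • E) l).map Polynomial.C).det.eval b < 0) :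
    ((∑ l, (Polynomial.X : ℝ[X]) ^ d l • (S l).map Polynomial.C).det.roots.toFinset.filter
        fun ρ => 0 < ρ).card ≤ 2 * B :=
  card_posRoots_le_two_mul_of_localSplit _
    (fun s ε t => (∑ l, (Polynomial.X : ℝ[X]) ^ d l •
      (Function.update S l₀ (S l₀ + (s * ε) • E) l).map Polynomial.C).det.eval t) B
    (fun s ε _ _ N τ hmono hpos halt =>
      H _ (isSymm_update_add_smul S hS l₀ E hE (s * ε)) N τ ⟨hmono, hpos, halt⟩)
    hloc

end Perturb

end Summit.ValiantsHypothesis.ValiantsHypothesis.Theorems.LacunarySymmetroidMatrixDescartes
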